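import Literature.MathematicalPhysics.KineticTheory.PrefixRungCellGain
import Literature.MathematicalPhysics.KineticTheory.PrefixRungHostGain
import Literature.MathematicalPhysics.KineticTheory.ReyBelletThomas2002Thm310TwoScale
import HarnessLib

/-!
# The pathwise high-energy energy drop of the prefix cell chain: two regimes, one fine grid (CEHR Prop. 5.3 for the mixed rung)

Trunk T-KINETIC (Literature/MathematicalPhysics/KineticTheory). The deterministic heart of
Cuneo–Eckmann–Hairer–Rey-Bellet 2018, Theorem 5.1, for the MIXED rung `cellChain ω₂ lam β γ (· < k)`
on `N = k + 1 + n` sites (`0 < k`; outside their Condition C3 by Remark 2.11; crux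
`PrefixSteadyStates` of `AtomisticToContinuum/FouriersLaw`). Along the pathwise solution
`z = drivenFlow Y x (0, η)` started at energy `H(x) = K⁴` and driven by a continuous momentum-noise
path `η` supported on the two bath sites with `‖η‖ ≤ δ₀K` on `[0, t*]`, the energy drops by a definite
fraction: `H(z(t*)) ≤ K⁴ - ρ₀K⁴` for `K ≥ K₀`. Proof: the two-sided energy bookkeeping
(`CellChainEnergyFlow.lean`) reduces the claim to a lower bound `γD(t*) ≥ ρ₀'K⁴` for the dissipation
`D(t) = ∫₀ᵗ ∑ᵢ wᵢ ȳᵢ²`; on the fine grid `t_j = j τ_f` (`J = 2m` steps, `m = ⌊K(t*+2)/2⌋`,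
`τ_f = t*/(2m) ≥ Λ/K` with `Λ = t*/(t*+2)`) EITHER some grid energy is `≤ K⁴/2` (then `γD ≥ (1/2-e)K⁴`
directly), OR every grid point is in one of two regimes: rescaled cell energy `≥ 1/8` — a unit step
gains `γ ε₁ K³/16` at the LEFT bath (`PrefixRungCellGain.lean`) — or `< 1/8` — an `m`-step (a window
`t*/2`) gains `c₀K⁴/(16(ω₂/2+4))` at the RIGHT bath (`PrefixRungHostGain.lean`; for an empty host block
this regime cannot occur); the bookkeeping lemma `twoScale_accounting` sums these to `≥ ρ₁K⁴`.
The two dynamical inputs — Prop. 5.14 for the limit cell chain and the observability of the damped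
harmonic host block — are displayed hypotheses (`hS5`, `hS4`), discharged in the crux by the landed
stubs `stub_prefixLimitDissipation`, `stub_prefixHostObservability`.

* `prefixHostEnergy_eq_zero_of_isEmpty` — an empty host block carries no energy;
* `prefixRung_pathwise_energy_drop` — the statement above.

## References

* N. Cuneo, J.-P. Eckmann, M. Hairer, L. Rey-Bellet, EJP 23 (2018) no. 55 (arXiv:1712.09413), Thm 5.1,
  Prop. 5.3, Cor. 5.4, §5.1–5.2, Remark 2.11.
* L. Rey-Bellet, L. E. Thomas, Comm. Math. Phys. 225 (2002) 305–329, Thm 3.10 (proof, p. 24: the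
  variable-length cells), through `twoScale_accounting`.
-/

noncomputable section

open MeasureTheory Filter Topology Set Metric Function Finset
open scoped NNReal

namespace Literature.MathematicalPhysics.KineticTheory.HeatConduction

open OscillatorChain Literature.Analysis.ODE Literature.MathematicalPhysics.KineticTheory

section Accounting

/- The limit cell chain of the prefix rung, as a structure literal (notation only, as in
`PrefixRungScaling.lean`). -/
set_option quotPrecheck false in
local notation "P₀⟦" lam ", " β ", " k "⟧" =>
  (SiteChain.mk (fun i q => (if i < k then lam else 0) * q ^ 4 / 4) (fun _ r => β * r ^ 4 / 4) 0)

variable {ω₂ lam β γ : ℝ} {k n : ℕ}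

/-- An empty host block carries no energy. [folklore] -/
theorem prefixHostEnergy_eq_zero_of_isEmpty (hn : n = 0) (w : PhaseSpace (k + 1 + n)) :
    prefixHostEnergy ω₂ k n w = 0 := by
  subst hn
  unfold prefixHostEnergy
  simp

set_option maxHeartbeats 3200000 in
/-- **CEHR Prop. 5.3 for the mixed rung, pathwise: a definite fraction of the energy is dissipated.**
Data: `ω₂, lam, β, γ > 0`, `0 < k`, `n` host sites, a time `t* > 0`, and the two dynamical inputs as
displayed hypotheses — `hS5`: CEHR Prop. 5.14 for the limit cell chain on the shell `[1/8, c₁ + 1]`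
over the rescaled window `Λ = t*/(t*+2)` with level `ε₁ > 0`; `hS4` (only for `n ≥ 1`): the
observability inequality of the damped harmonic host block over `[0, t*/2]` with constants
`c₀ > 0`, `C₀ ≥ 0`. Conclusion: there are `δ₀ > 0`, `ρ₀ > 0`, `K₀ ≥ 1` such that for `K ≥ K₀`, every
start of energy `K⁴` and every continuous bath-supported noise path of size `≤ δ₀K` on `[0, t*]`, the
driven path satisfies `H(z(t*)) ≤ K⁴ - ρ₀K⁴`.
[cite: CuneoEckmannHairerReyBellet2018, Thm 5.1 and Prop 5.3] -/
theorem prefixRung_pathwise_energy_drop (hω : 0 < ω₂) (hl : 0 < lam) (hβ : 0 < β) (hγ : 0 < γ) (hk : 0 < k)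
    {tstar ε₁ c₀ C₀ : ℝ} (ht : 0 < tstar) (hε₁ : 0 < ε₁) (hc₀ : 0 < c₀) (hC₀ : 0 ≤ C₀)
    (hS5 : ∀ (xh : PhaseSpace (k + 1)) (y : ℝ → PhaseSpace (k + 1)),
      1 / 8 ≤ P₀⟦lam, β, k⟧.hamiltonian (k + 1) xh →
      P₀⟦lam, β, k⟧.hamiltonian (k + 1) xh ≤ pinnedChainScaleC ω₂ lam β γ (k + 1 + n) + 1 →
      Continuous y → y 0 = xh →
      (∀ t ∈ Ioo 0 (tstar / (tstar + 2)), HasDerivAt y (SiteChain.langevinDrift P₀⟦lam, β, k⟧ (k + 1) (y t)) t) →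
      ε₁ ≤ ∫ s in (0 : ℝ)..tstar / (tstar + 2), (y s).2 ⟨0, Nat.succ_pos k⟩ ^ 2)
    (hS4 : ∀ hn : 0 < n, ∀ (Mu Mξ : ℝ) (u ξ : ℝ → ℝ) (X : ℝ → PhaseSpace n),
      Continuous u → Continuous ξ → Continuous X →
      (∀ t ∈ Icc (0 : ℝ) (tstar / 2), |u t| ≤ Mu) → (∀ t ∈ Icc (0 : ℝ) (tstar / 2), |ξ t| ≤ Mξ) →
      (∀ t ∈ Icc (0 : ℝ) (tstar / 2),
        X t = X 0 + ((0 : Fin n → ℝ), fun j : Fin n => if j.val = n - 1 then ξ t else 0) +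
          ∫ s in (0 : ℝ)..t,
            ((X s).2, fun j : Fin n =>
              -(ω₂ * (X s).1 j) +
                (if h : j.val + 1 < n then (X s).1 ⟨j.val + 1, h⟩ - (X s).1 j else 0) -
                (if h : 0 < j.val then (X s).1 j - (X s).1 ⟨j.val - 1, by omega⟩
                  else (X s).1 j - u s) -
                (if j.val = n - 1 then γ * (X s).2 j else 0))) →
      c₀ * (∑ j, ((X 0).1 j ^ 2 + (X 0).2 j ^ 2)) - C₀ * (Mu ^ 2 + Mξ ^ 2) ≤
        γ * ∫ s in (0 : ℝ)..tstar / 2, ((X s).2 ⟨n - 1, by omega⟩ - ξ s) ^ 2) :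
    ∃ δ₀ ρ₀ K₀ : ℝ, 0 < δ₀ ∧ 0 < ρ₀ ∧ 1 ≤ K₀ ∧ ∀ K : ℝ, K₀ ≤ K → ∀ (x : PhaseSpace (k + 1 + n)),
      (cellChain ω₂ lam β γ (fun i => decide (i < k))).hamiltonian (k + 1 + n) x = K ^ 4 →
      ∀ (η : ℝ → Fin (k + 1 + n) → ℝ), Continuous η →
      (∀ t (i : Fin (k + 1 + n)), i.val ≠ 0 → i.val + 1 ≠ k + 1 + n → η t i = 0) →
      (∀ t ∈ Icc 0 tstar, ‖η t‖ ≤ δ₀ * K) →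
      (cellChain ω₂ lam β γ (fun i => decide (i < k))).hamiltonian (k + 1 + n)
        (drivenFlow ((cellChain ω₂ lam β γ (fun i => decide (i < k))).langevinDrift (k + 1 + n)) x
          (fun s => ((0 : Fin (k + 1 + n) → ℝ), η s)) tstar) ≤ K ^ 4 - ρ₀ * K ^ 4 := by
  set N := k + 1 + n with hNdef
  set P := cellChain ω₂ lam β γ (fun i => decide (i < k)) with hP
  have hUC := cellChain_uniformlyConfining hω hl.le hβ.le hγ.le (fun i => decide (i < k))
  have hkN : k + 1 ≤ N := Nat.le_add_right _ _
  -- the bookkeeping constants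
  set A := pinnedChainScaleA γ N with hA
  set Bc := pinnedChainScaleB ω₂ lam β γ N with hBc
  set c₁ := pinnedChainScaleC ω₂ lam β γ N with hc₁
  have hA1 : 1 ≤ A := one_le_pinnedChainScaleA hγ.le N
  have hB0 : 0 ≤ Bc := pinnedChainScaleB_nonneg hω.le hl.le hβ.le hγ.le N
  have hc₁0 : 0 ≤ c₁ := pinnedChainScaleC_nonneg hω.le hl.le hβ.le hγ.le N
  set C₂ : ℝ := A * c₁ + Bc + N * (c₁ + 1 / 2) with hC₂
  have hC₂0 : 0 < C₂ := by
    have hN1 : (1 : ℝ) ≤ N := by exact_mod_cast (show 1 ≤ N by omega)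
    have h1 : 0 ≤ A * c₁ := mul_nonneg (by linarith only [hA1]) hc₁0
    have h2 : (1 : ℝ) / 2 ≤ N * (c₁ + 1 / 2) := by
      have := mul_le_mul hN1 (show (1:ℝ)/2 ≤ c₁ + 1/2 by linarith only [hc₁0]) (by norm_num) (by linarith only [hN1])
      linarith only [this]
    rw [hC₂]; linarith only [h1, h2, hB0]
  -- the windows and the gains
  set Λ : ℝ := tstar / (tstar + 2) with hΛ
  have hΛ0 : 0 < Λ := by rw [hΛ]; positivity
  set D : ℝ := ω₂ / 2 + 4 with hD
  have hD0 : 0 < D := by rw [hD]; positivity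
  set ρ₁ : ℝ := min (γ * ε₁ / 32) (c₀ / (16 * D)) with hρ₁
  have hρ₁0 : 0 < ρ₁ := lt_min (by positivity) (by positivity)
  set ρ₂ : ℝ := min ρ₁ (1 / 4) with hρ₂
  have hρ₂0 : 0 < ρ₂ := lt_min hρ₁0 (by norm_num)
  have hρ₂1 : ρ₂ ≤ ρ₁ := min_le_left _ _
  have hρ₂4 : ρ₂ ≤ 1 / 4 := min_le_right _ _
  -- the noise size: `A δ₀ t* ≤ 1`, `δ₀ ≤ 1`, and the bookkeeping error `e = C₂δ₀(t*+2) ≤ ρ₂/2`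
  set δ₀ : ℝ := min (min 1 (1 / (A * tstar))) (ρ₂ / (2 * C₂ * (tstar + 2))) with hδ₀
  have hδ₀0 : 0 < δ₀ := lt_min (lt_min one_pos (by positivity)) (by positivity)
  have hδ₁ : δ₀ ≤ 1 := (min_le_left _ _).trans (min_le_left _ _)
  have hδA : δ₀ ≤ 1 / (A * tstar) := (min_le_left _ _).trans (min_le_right _ _)
  have hδe : δ₀ ≤ ρ₂ / (2 * C₂ * (tstar + 2)) := min_le_right _ _
  set e : ℝ := C₂ * δ₀ * (tstar + 2) with he
  have he0 : 0 ≤ e := by rw [he]; positivity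
  have heρ : e ≤ ρ₂ / 2 := by
    rw [he]
    have h := mul_le_mul_of_nonneg_left hδe (by positivity : 0 ≤ C₂ * (tstar + 2))
    calc C₂ * δ₀ * (tstar + 2) = C₂ * (tstar + 2) * δ₀ := by ring
      _ ≤ C₂ * (tstar + 2) * (ρ₂ / (2 * C₂ * (tstar + 2))) := h
      _ = ρ₂ / 2 := by field_simp
  -- the regime gains
  obtain ⟨Kc, hKc1, hcell⟩ := prefixRung_cellRegime_gain (lam := lam) (β := β) (n := n) hω hl hβ hγ.le hk
    (Λ := Λ) (δ₀ := δ₀) (εc := 1 / 8) (ε₁ := ε₁) hΛ0 hδ₀0 hδ₁ hε₁ hS5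
  have hhost : ∃ Kh : ℝ, 1 ≤ Kh ∧ ∀ hn : 0 < n, ∀ K : ℝ, Kh ≤ K → ∀ (x : PhaseSpace N),
      P.hamiltonian N x ≤ 2 * K ^ 4 →
      ∀ (η : ℝ → Fin N → ℝ) (T : ℝ), Continuous η →
      (∀ t (i : Fin N), i.val ≠ 0 → i.val + 1 ≠ k + 1 + n → η t i = 0) →
      (∀ t ∈ Icc 0 T, ‖η t‖ ≤ δ₀ * K) → pinnedChainScaleA γ N * (δ₀ * K) * T ≤ K →
      ∀ s₀ : ℝ, 0 ≤ s₀ → s₀ + tstar / 2 ≤ T →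
      P₀⟦lam, β, k⟧.hamiltonian (k + 1) (prefixRungProj k N hkN
        (rescale K (drivenFlow (P.langevinDrift N) x (fun s => ((0 : Fin N → ℝ), η s)) s₀))) ≤ 1 / 8 →
      K ^ 4 / 2 ≤ P.hamiltonian N (drivenFlow (P.langevinDrift N) x (fun s => ((0 : Fin N → ℝ), η s)) s₀) →
      c₀ / (16 * γ * (ω₂ / 2 + 4)) * K ^ 4 ≤ ∫ t in s₀..s₀ + tstar / 2,
        (drivenFlow (P.langevinDrift N) x (fun s => ((0 : Fin N → ℝ), η s)) t - ((0 : Fin N → ℝ), η t)).2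
          (Fin.natAdd (k + 1) ⟨n - 1, by omega⟩) ^ 2 := by
    rcases Nat.eq_zero_or_pos n with hn0 | hnpos
    · exact ⟨1, le_rfl, fun hn => absurd hn (by omega)⟩
    · obtain ⟨Kh, hKh1, hh⟩ := prefixRung_hostRegime_gain (lam := lam) (β := β) hω hl hβ hγ hk hnpos
        (τ := tstar / 2) (δ₀ := δ₀) (εc := 1 / 8) (c₀ := c₀) (C₀ := C₀) (by positivity) hδ₀0 le_rfl hc₀ hC₀
        (hS4 hnpos)
      exact ⟨Kh, hKh1, fun _ => hh⟩
  obtain ⟨Kh, hKh1, hhostg⟩ := hhost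
  -- the harmonic cell bound (empty-host contradiction)
  set Cq : ℝ := 2 * (max 1 (4 * c₁ / lam) + max 1 (4 * c₁ / β)) with hCq
  have hCq0 : 0 ≤ Cq := by
    have := le_max_left 1 (4 * c₁ / lam); have := le_max_left 1 (4 * c₁ / β); rw [hCq]; linarith
  set Ch : ℝ := (k + 1) * (ω₂ / 2 + 2) * Cq ^ 2 with hCh
  have hCh0 : 0 ≤ Ch := by rw [hCh]; positivity
  -- the threshold
  set K₀ : ℝ := max (max (max Kc Kh) (2 / tstar + 2)) (4 * Ch + 1) with hK₀
  refine ⟨δ₀, ρ₂ / 2, K₀, hδ₀0, by positivity, hKc1.trans ((le_max_left _ _).trans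
    ((le_max_left _ _).trans (le_max_left _ _))), ?_⟩
  intro K hK x hx η hη hsupp hM
  have hKKc : Kc ≤ K := ((le_max_left _ _).trans ((le_max_left _ _).trans (le_max_left _ _))).trans hK
  have hKKh : Kh ≤ K := ((le_max_right _ _).trans ((le_max_left _ _).trans (le_max_left _ _))).trans hK
  have hKt : 2 / tstar + 2 ≤ K := ((le_max_right _ _).trans (le_max_left _ _)).trans hK
  have hKCh : 4 * Ch + 1 ≤ K := (le_max_right _ _).trans hK
  have hK1 : 1 ≤ K := hKc1.trans hKKc
  have hK0 : 0 < K := by linarith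
  -- the path, the bookkeeping over `[0, t*]`
  set Y := P.langevinDrift N with hY
  set z : ℝ → PhaseSpace N := drivenFlow Y x (fun s => ((0 : Fin N → ℝ), η s)) with hz
  have hzc : Continuous z := hUC.continuous_drivenFlow N x hη
  have hx2 : P.hamiltonian N x ≤ 2 * K ^ 4 := by rw [hx]; linarith only [pow_nonneg hK0.le 4]
  have hAMT : pinnedChainScaleA γ N * (δ₀ * K) * tstar ≤ K := by
    rw [← hA]
    have h1 : A * δ₀ * tstar ≤ 1 := by
      have h2 := mul_le_mul_of_nonneg_left hδA (by positivity : 0 ≤ A * tstar)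
      have e2 : A * tstar * (1 / (A * tstar)) = 1 := by field_simp
      have e3 : A * δ₀ * tstar = A * tstar * δ₀ := by ring
      rw [e3]; linarith only [h2, e2]
    calc A * (δ₀ * K) * tstar = (A * δ₀ * tstar) * K := by ring
      _ ≤ 1 * K := mul_le_mul_of_nonneg_right h1 hK0.le
      _ = K := one_mul K
  set f : ℝ → ℝ := fun s => ∑ i, bathWeight N i * (z s - ((0 : Fin N → ℝ), η s)).2 i ^ 2 with hf
  set Dis : ℝ → ℝ := fun t => ∫ s in (0 : ℝ)..t, f s with hDis
  have hES : ∀ t ∈ Icc 0 tstar, P.hamiltonian N (z t - ((0 : Fin N → ℝ), η t)) ≤ c₁ * K ^ 4 ∧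
      |P.hamiltonian N (z t) - P.hamiltonian N x + γ * Dis t| ≤ C₂ * (δ₀ * K) * (tstar * K ^ 3 + K ^ 2 + δ₀ * K) := by
    intro t htt
    exact cellChain_drivenFlow_energyScale hω hl.le hβ.le hγ.le (fun i => decide (i < k)) N hK1 x hx2 η tstar
      (δ₀ * K) hη hM hAMT t htt
  -- the bookkeeping error is `≤ e K⁴`
  have herr : C₂ * (δ₀ * K) * (tstar * K ^ 3 + K ^ 2 + δ₀ * K) ≤ e * K ^ 4 := by
    rw [he]
    have h1 : tstar * K ^ 3 + K ^ 2 + δ₀ * K ≤ (tstar + 2) * K ^ 3 := by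
      have hK3 : K ^ 2 ≤ K ^ 3 := by
        have := pow_le_pow_right₀ hK1 (show 2 ≤ 3 by norm_num); exact this
      have hK4 : δ₀ * K ≤ K ^ 3 := by
        have h5 : δ₀ * K ≤ 1 * K := mul_le_mul_of_nonneg_right hδ₁ hK0.le
        have h6 : K ≤ K ^ 3 := by
          have := pow_le_pow_right₀ hK1 (show 1 ≤ 3 by norm_num); simpa using this
        linarith only [h5, h6]
      linarith only [hK3, hK4]
    have h2 := mul_le_mul_of_nonneg_left h1 (by positivity : 0 ≤ C₂ * (δ₀ * K))
    calc C₂ * (δ₀ * K) * (tstar * K ^ 3 + K ^ 2 + δ₀ * K) ≤ C₂ * (δ₀ * K) * ((tstar + 2) * K ^ 3) := h2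
      _ = C₂ * δ₀ * (tstar + 2) * K ^ 4 := by ring
  have htwo : ∀ t ∈ Icc 0 tstar, |P.hamiltonian N (z t) - K ^ 4 + γ * Dis t| ≤ e * K ^ 4 := by
    intro t htt
    have h := (hES t htt).2
    rw [hx] at h
    exact h.trans herr
  -- the dissipation is monotone
  have hw0 : ∀ i, 0 ≤ bathWeight N i := fun i => by unfold bathWeight; split_ifs <;> norm_num
  have hfc : Continuous f := by
    have hc1 : Continuous fun s => z s - ((0 : Fin N → ℝ), η s) := hzc.sub (continuous_const.prodMk hη)
    refine continuous_finsetSum _ fun i _ => continuous_const.mul ?_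
    exact ((continuous_apply i).comp (continuous_snd.comp hc1)).pow 2
  have hf0 : ∀ s, 0 ≤ f s := fun s => Finset.sum_nonneg fun i _ => mul_nonneg (hw0 i) (sq_nonneg _)
  have hDis_sub : ∀ a b : ℝ, Dis b - Dis a = ∫ s in a..b, f s := by
    intro a b
    simp only [hDis]
    rw [← intervalIntegral.integral_add_adjacent_intervals (hfc.intervalIntegrable 0 a) (hfc.intervalIntegrable a b)]
    ring
  have hDis_mono : ∀ a b : ℝ, a ≤ b → Dis a ≤ Dis b := by
    intro a b hab
    have h := hDis_sub a b
    have h0 : 0 ≤ ∫ s in a..b, f s := intervalIntegral.integral_nonneg hab fun s _ => hf0 s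
    linarith
  have hDis0 : Dis 0 = 0 := by simp [hDis]
  -- a single bath term is below the integrand
  have hf_ge : ∀ (i : Fin N), 1 ≤ bathWeight N i → ∀ s, (z s - ((0 : Fin N → ℝ), η s)).2 i ^ 2 ≤ f s := by
    intro i hi s
    calc (z s - ((0 : Fin N → ℝ), η s)).2 i ^ 2 ≤ bathWeight N i * (z s - ((0 : Fin N → ℝ), η s)).2 i ^ 2 := by
          have h5 := mul_le_mul_of_nonneg_right hi (sq_nonneg ((z s - ((0 : Fin N → ℝ), η s)).2 i))
          linarith only [h5]
      _ ≤ f s := Finset.single_le_sum (f := fun j => bathWeight N j * (z s - ((0 : Fin N → ℝ), η s)).2 j ^ 2)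
          (fun j _ => mul_nonneg (hw0 j) (sq_nonneg _)) (Finset.mem_univ i)
  have hN0 : 0 < N := by rw [hNdef]; omega
  have hbw0 : 1 ≤ bathWeight N ⟨0, hN0⟩ := by
    unfold bathWeight
    rw [if_pos (show ((⟨0, hN0⟩ : Fin N) : ℕ) = 0 from rfl)]
    split_ifs <;> norm_num
  have hbwL : ∀ hn : 0 < n, 1 ≤ bathWeight N (Fin.natAdd (k + 1) ⟨n - 1, by omega⟩) := by
    intro hn
    unfold bathWeight
    simp only [Fin.val_natAdd]
    have hv : k + 1 + (n - 1) = N - 1 := by rw [hNdef]; omega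
    rw [if_neg (show ¬ (k + 1 + (n - 1) = 0) by omega), if_pos hv]
    norm_num
  -- the grid
  set m : ℕ := ⌊K * (tstar + 2) / 2⌋₊ with hmdef
  have hmle : (m : ℝ) ≤ K * (tstar + 2) / 2 := Nat.floor_le (by positivity)
  have hmge : K * (tstar + 2) / 2 - 1 ≤ m := (Nat.sub_one_lt_floor _).le
  have hmK : K / 2 ≤ m := by
    have h1 : 1 ≤ K * tstar / 2 := by
      have h2 : 2 / tstar ≤ K := by linarith
      have := (div_le_iff₀ ht).1 h2
      linarith
    linarith
  have hm1 : 1 ≤ m := by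
    have h22 : 0 < 2 / tstar := by positivity
    have h : (1 : ℝ) ≤ m := by linarith only [hmK, hKt, h22]
    exact_mod_cast h
  have hm0 : (0 : ℝ) < m := by exact_mod_cast hm1
  set τf : ℝ := tstar / (2 * m) with hτf
  have hτf0 : 0 < τf := by rw [hτf]; positivity
  have hmτ : (m : ℝ) * τf = tstar / 2 := by rw [hτf]; field_simp
  have hJτ : ((2 * m : ℕ) : ℝ) * τf = tstar := by push_cast; rw [hτf]; field_simp
  have hΛτ : Λ / K ≤ τf := by
    -- `Λ/K = t*/((t*+2)K) ≤ t*/(2m)` since `2m ≤ K(t*+2)`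
    rw [hΛ, hτf, div_div, div_le_div_iff_of_pos_left ht (by positivity) (by positivity)]
    linarith
  have hgrid : ∀ j : ℕ, j ≤ 2 * m → (j : ℝ) * τf ∈ Icc 0 tstar := by
    intro j hj
    refine ⟨by positivity, ?_⟩
    have h1 : (j : ℝ) ≤ ((2 * m : ℕ) : ℝ) := by exact_mod_cast hj
    calc (j : ℝ) * τf ≤ ((2 * m : ℕ) : ℝ) * τf := mul_le_mul_of_nonneg_right h1 hτf0.le
      _ = tstar := hJτ
  set Γ : ℕ → ℝ := fun j => γ * Dis (j * τf) with hΓ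
  have hΓmono : Monotone Γ := by
    intro a b hab
    simp only [hΓ]
    refine mul_le_mul_of_nonneg_left (hDis_mono _ _ ?_) hγ.le
    exact mul_le_mul_of_nonneg_right (by exact_mod_cast hab) hτf0.le
  -- the goal in terms of the dissipation
  have hfinish : ∀ {d : ℝ}, d ≤ γ * Dis tstar → (ρ₂ / 2) * K ^ 4 ≤ d - e * K ^ 4 →
      P.hamiltonian N (z tstar) ≤ K ^ 4 - ρ₂ / 2 * K ^ 4 := by
    intro d hd hρd
    have h := htwo tstar ⟨ht.le, le_rfl⟩
    have h1 := (abs_le.1 h).2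
    linarith
  -- CASE A: some grid energy is `≤ K⁴/2`
  by_cases hlow : ∃ j : ℕ, j ≤ 2 * m ∧ P.hamiltonian N (z (j * τf)) ≤ K ^ 4 / 2
  · obtain ⟨j, hj, hjE⟩ := hlow
    have htj := hgrid j hj
    have h := htwo _ htj
    have h1 := (abs_le.1 h).1
    have hmono := hDis_mono _ _ htj.2
    refine hfinish (d := γ * Dis (j * τf)) (mul_le_mul_of_nonneg_left hmono hγ.le) ?_
    have hK4 : 0 ≤ K ^ 4 := by positivity
    -- `γ D(t_j) ≥ K⁴ - K⁴/2 - eK⁴`, `ρ₂/2 + e ≤ 1/2 - e`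
    have h3 : (ρ₂ / 2 + 2 * e) * K ^ 4 ≤ (1 / 2) * K ^ 4 :=
      mul_le_mul_of_nonneg_right (by linarith only [heρ, hρ₂4]) hK4
    linarith only [h1, hjE, h3]
  -- CASE B: every grid energy is `> K⁴/2`
  push Not at hlow
  set reg : ℕ → Prop := fun j => 1 / 8 ≤ P₀⟦lam, β, k⟧.hamiltonian (k + 1)
    (prefixRungProj k N hkN (rescale K (z (j * τf)))) with hreg
  set dᵢ : ℝ := γ * (ε₁ / 16 * K ^ 3) with hdᵢ
  set dₚ : ℝ := γ * (c₀ / (16 * γ * (ω₂ / 2 + 4)) * K ^ 4) with hdₚ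
  have hdᵢ0 : 0 ≤ dᵢ := by positivity
  have hdₚ0 : 0 ≤ dₚ := by positivity
  -- (hi) a cell-regime unit step
  have hi : ∀ j : ℕ, j < 2 * m → reg j → dᵢ ≤ Γ (j + 1) - Γ j := by
    intro j hj hregj
    have hs₀ : 0 ≤ (j : ℝ) * τf := by positivity
    have hs₁ : (j : ℝ) * τf + Λ / K ≤ tstar := by
      have h1 : ((j + 1 : ℕ) : ℝ) * τf ≤ tstar := (hgrid (j + 1) hj).2
      push_cast at h1
      linarith
    have hg := hcell K hKKc x hx2 η tstar hη hM hAMT ((j : ℝ) * τf) hs₀ hs₁ hregj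
    -- `Γ(j+1) - Γ(j) = γ ∫_{t_j}^{t_{j+1}} f ≥ γ ∫_{t_j}^{t_j+Λ/K} ȳ₀²`
    simp only [hΓ]
    rw [← mul_sub, hDis_sub]
    refine mul_le_mul_of_nonneg_left ?_ hγ.le
    have hsub : ∫ s in (j : ℝ) * τf..(j : ℝ) * τf + Λ / K, f s ≤ ∫ s in (j : ℝ) * τf..((j + 1 : ℕ) : ℝ) * τf, f s := by
      refine intervalIntegral.integral_mono_interval le_rfl (by linarith only [div_pos hΛ0 hK0]) ?_
        (Eventually.of_forall fun s => hf0 s) (hfc.intervalIntegrable _ _)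
      push_cast; linarith
    have hterm : ∫ s in (j : ℝ) * τf..(j : ℝ) * τf + Λ / K, (z s - ((0 : Fin N → ℝ), η s)).2 ⟨0, by omega⟩ ^ 2 ≤
        ∫ s in (j : ℝ) * τf..(j : ℝ) * τf + Λ / K, f s :=
      intervalIntegral.integral_mono_on (by linarith only [div_pos hΛ0 hK0])
        ((((continuous_apply _).comp (continuous_snd.comp (hzc.sub (continuous_const.prodMk hη)))).pow 2).intervalIntegrable _ _)
        (hfc.intervalIntegrable _ _) fun s _ => hf_ge _ hbw0 s
    push_cast at hsub ⊢
    linarith only [hg, hterm, hsub]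
  -- (hp) a host-regime `m`-step
  have hp : ∀ j : ℕ, j + m ≤ 2 * m → ¬ reg j → dₚ ≤ Γ (j + m) - Γ j := by
    intro j hjm hnreg
    have hnreg' : P₀⟦lam, β, k⟧.hamiltonian (k + 1) (prefixRungProj k N hkN (rescale K (z (j * τf)))) ≤ 1 / 8 :=
      (not_le.1 hnreg).le
    have hjE : K ^ 4 / 2 ≤ P.hamiltonian N (z (j * τf)) := (hlow j (by omega)).le
    have htj := hgrid j (by omega)
    -- the host block is nonempty: otherwise the energy would be `≤ K⁴/8 + Ch K² < K⁴/2`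
    have hnpos : 0 < n := by
      by_contra hn0
      have hn00 : n = 0 := by omega
      have hsplit : P.hamiltonian N (z (j * τf)) =
          K ^ 4 * P₀⟦lam, β, k⟧.hamiltonian (k + 1) (prefixRungProj k N hkN (rescale K (z (j * τf)))) +
            prefixCellHarm ω₂ k n (z (j * τf)) + prefixHostEnergy ω₂ k n (z (j * τf)) :=
        prefixRung_hamiltonian_split (ω₂ := ω₂) (lam := lam) (β := β) (γ := γ) (k := k) (n := n)
          hK0.ne' hkN (z (j * τf))
      have hq : ∀ i : Fin (k + 1), |(z (j * τf)).1 (Fin.castAdd n i)| ≤ Cq * K := by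
        intro i
        have e1 : (z (j * τf)).1 (Fin.castAdd n i) = (z (j * τf) - ((0 : Fin N → ℝ), η (j * τf))).1 (Fin.castAdd n i) := by
          simp
        rw [e1]
        exact prefixRung_abs_fst_le_of_hamiltonian_le hω.le hl hβ hk hK0 _ (hES _ htj).1 _ (by simp; omega)
      have hharm : prefixCellHarm ω₂ k n (z (j * τf)) ≤ Ch * K ^ 2 := by
        have h := prefixCellHarm_le (ω₂ := ω₂) (k := k) (n := n) hω.le (K := K) (Cq := Cq) (z (j * τf)) hq
        rw [hCh]; linarith
      have hhost0 := prefixHostEnergy_eq_zero_of_isEmpty (ω₂ := ω₂) (k := k) hn00 (z (j * τf))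
      have hK4 : 0 ≤ K ^ 4 := by positivity
      have h1 : K ^ 4 * P₀⟦lam, β, k⟧.hamiltonian (k + 1) (prefixRungProj k N hkN (rescale K (z (j * τf)))) ≤
          K ^ 4 * (1 / 8) := mul_le_mul_of_nonneg_left hnreg' hK4
      -- `Ch K² ≤ K⁴/4` since `K ≥ 4Ch + 1 ≥ 1`
      have h2 : Ch * K ^ 2 ≤ K ^ 4 / 4 := by
        have h3 : 4 * Ch ≤ K := by linarith only [hKCh]
        have h4 : 4 * Ch * K ^ 2 ≤ K * K ^ 2 := mul_le_mul_of_nonneg_right h3 (by positivity)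
        have h5 : K * K ^ 2 ≤ K ^ 4 := by
          have h6 : K ^ 3 ≤ K ^ 4 := pow_le_pow_right₀ hK1 (by norm_num)
          have e6 : K * K ^ 2 = K ^ 3 := by ring
          rw [e6]; exact h6
        linarith only [h4, h5]
      have hK4' : 0 < K ^ 4 := by positivity
      linarith only [hsplit, hjE, h1, hharm, hhost0, h2, hK4']
    have hs₀ : 0 ≤ (j : ℝ) * τf := by positivity
    have hs₁ : (j : ℝ) * τf + tstar / 2 ≤ tstar := by
      have h1 : ((j + m : ℕ) : ℝ) * τf ≤ tstar := (hgrid (j + m) hjm).2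
      push_cast at h1
      rw [add_mul, hmτ] at h1
      exact h1
    have hg := hhostg hnpos K hKKh x hx2 η tstar hη hsupp hM hAMT ((j : ℝ) * τf) hs₀ hs₁ hnreg' hjE
    simp only [hΓ]
    rw [← mul_sub, hDis_sub]
    refine mul_le_mul_of_nonneg_left ?_ hγ.le
    have hend : ((j + m : ℕ) : ℝ) * τf = (j : ℝ) * τf + tstar / 2 := by push_cast; rw [add_mul, hmτ]
    rw [hend]
    have hterm : ∫ s in (j : ℝ) * τf..(j : ℝ) * τf + tstar / 2,
        (z s - ((0 : Fin N → ℝ), η s)).2 (Fin.natAdd (k + 1) ⟨n - 1, by omega⟩) ^ 2 ≤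
        ∫ s in (j : ℝ) * τf..(j : ℝ) * τf + tstar / 2, f s :=
      intervalIntegral.integral_mono_on (by linarith)
        ((((continuous_apply _).comp (continuous_snd.comp (hzc.sub (continuous_const.prodMk hη)))).pow 2).intervalIntegrable _ _)
        (hfc.intervalIntegrable _ _) fun s _ => hf_ge _ (hbwL hnpos) s
    linarith only [hg, hterm]
  -- the accounting
  set ρ : ℝ := min dᵢ (dₚ / m) with hρ
  have hρ0 : 0 ≤ ρ := le_min hdᵢ0 (by positivity)
  have hρi : ρ ≤ dᵢ := min_le_left _ _
  have hρp : (m : ℝ) * ρ ≤ dₚ := by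
    have h1 : ρ ≤ dₚ / m := min_le_right _ _
    have := mul_le_mul_of_nonneg_left h1 hm0.le
    rwa [mul_div_cancel₀ _ hm0.ne'] at this
  have hacc := twoScale_accounting (Γ := Γ) (reg := reg) (J := 2 * m) (m := m) hm1 hρ0 hρi hρp hΓmono hi hp
  -- `ρ (J - m) = ρ m ≥ ρ₁ K⁴`
  have hJm : ((2 * m : ℕ) : ℝ) - m = m := by push_cast; ring
  rw [hJm] at hacc
  have hρm : ρ₁ * K ^ 4 ≤ ρ * m := by
    -- `ρ m = min(dᵢ m, dₚ)`, `dᵢ m ≥ γ ε₁ K⁴/32`, `dₚ = c₀ K⁴/(16 D)`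
    have h1 : ρ * m = min (dᵢ * m) dₚ := by
      rw [hρ, min_mul_of_nonneg _ _ hm0.le, div_mul_cancel₀ _ hm0.ne']
    rw [h1]
    refine le_min ?_ ?_
    · have h2 : γ * ε₁ / 32 * K ^ 4 ≤ dᵢ * m := by
        rw [hdᵢ]
        have h3 := mul_le_mul_of_nonneg_left hmK (by positivity : 0 ≤ γ * (ε₁ / 16 * K ^ 3))
        calc γ * ε₁ / 32 * K ^ 4 = γ * (ε₁ / 16 * K ^ 3) * (K / 2) := by ring
          _ ≤ γ * (ε₁ / 16 * K ^ 3) * m := h3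
      exact (mul_le_mul_of_nonneg_right (min_le_left _ _) (by positivity)).trans h2
    · have h2 : dₚ = c₀ / (16 * D) * K ^ 4 := by rw [hdₚ, hD]; field_simp
      rw [h2]
      exact mul_le_mul_of_nonneg_right (min_le_right _ _) (by positivity)
  have hΓ0 : Γ 0 = 0 := by simp [hΓ, hDis0]
  have hΓJ : Γ (2 * m) = γ * Dis tstar := by
    simp only [hΓ]
    rw [hJτ]
  rw [hΓ0, sub_zero, hΓJ] at hacc
  refine hfinish (d := ρ * m) hacc ?_
  have hK4 : 0 ≤ K ^ 4 := by positivity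
  have h3 : (ρ₂ / 2 + e) * K ^ 4 ≤ ρ₁ * K ^ 4 :=
    mul_le_mul_of_nonneg_right (by linarith only [heρ, hρ₂1]) hK4
  linarith only [hρm, h3]

end Accounting

end Literature.MathematicalPhysics.KineticTheory.HeatConduction
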